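import Summits.ResolutionOfSingularities.ResolutionOfSingularities.Theorems.MarkedTransferCampaignW46PlaneProcrastinationCurve
import Summits.ResolutionOfSingularities.ResolutionOfSingularities.Theorems.MarkedTransferCampaignW46ExitTreeGerm
import Literature.AlgebraicGeometry.Resolution.DivisorialPartLemmas
import HarnessLib

/-!
# [OURS · L1 W4.6 rung (i-b)] No infinite tail of curve blow-ups: the DIVISORIAL SUM `Σ_ζ ord_ζ J` over the codimension-one
# points of `V(J)` drops at every blow-up of a regular curve of the singular locus of a surface
# (cell res-hironaka, LADDER-RESOLUTION rung L, D-0089; campaign s46, prover res-L1-s46-pv-1; host route MarkedTransfer,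
# `--supports stmt-ResolutionOfSingularities-16155`)

HONEST FRAMING. Nothing here is a statement of H. Hironaka's manuscript (2017-03-23, [Hironaka2017]); OURS bookkeeping over the
tree's prime-divisor calculus (`PrimeDivisorIdeals.lean`, `DivisorialPart.lean`: `divisorialPoints`, `I_ζ = 𝔪_ζ^{ord}` at a
codimension-one point of a regular scheme), the stalks of the controlled transform, and res-L1-s46-pv-8's DVR colon computation
(`colon_span_pow_eq`, `…ExitTreeGerm.lean`). AI-written; weaker than expert review. No `sorry`; axioms standard.

## Contents

* `divisorialSum J = Σ_{ζ ∈ divisorialPoints J} ord_ζ J` (a natural number; `0` if the set is infinite — never the case on a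
  Noetherian integral scheme for `J ≠ 0`).
* **`divisorialSum_transform_lt_of_curveCentre`** — along the blow-up `π` (an isomorphism) of an ambient scheme at a permissible
  centre whose generic point `η` has codimension one, `divisorialSum J′ < divisorialSum J` for the transform `J′ = (J𝒪′ : 𝓘_D^b)`:
  the codimension-one points of `V(J′)` map injectively to those of `V(J)` with `ord` not increased, and the order at `η` drops
  by `b ≥ 1` (or `η` disappears from `V(J′)`).

## References

* V. Cossart, O. Piltant, J. Algebra 320 (2008), proof of Prop. 4.2. [CossartPiltant2008]
-/

noncomputable section

set_option linter.dupNamespace false -- mandated namespace of this single-conjunct summit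

open CategoryTheory AlgebraicGeometry TopologicalSpace IsLocalRing

namespace Summit.ResolutionOfSingularities.ResolutionOfSingularities.Theorems

namespace CampaignW46

open Literature.AlgebraicGeometry.Resolution
open Literature.AlgebraicGeometry.Hironaka2017.S02Preliminaries
open Scheme.IdealSheafData

universe u

/-! ## The divisorial sum -/

open Classical in
/-- **The divisorial sum** `Σ_{ζ} ord_ζ(J)` over the codimension-one points `ζ` of `V(J)` (the total multiplicity of the
divisorial part `∑ a(i) E_i` of `J`; junk `0` if there are infinitely many such points). [folklore] -/
def divisorialSum {X : Scheme.{u}} (J : X.IdealSheafData) : ℕ :=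
  if h : (divisorialPoints J).Finite then ∑ ζ ∈ h.toFinset, (idealOrder J ζ).toNat else 0

/-- Unfolding the divisorial sum. [folklore] -/
theorem divisorialSum_eq {X : Scheme.{u}} {J : X.IdealSheafData} (h : (divisorialPoints J).Finite) :
    divisorialSum J = ∑ ζ ∈ h.toFinset, (idealOrder J ζ).toNat := by
  classical
  rw [divisorialSum, dif_pos h]

/-! ## Orders at codimension-one points under the blow-up of a regular curve -/

section Colon

variable {R : Type u} [CommRing R]

/-- `(J : 𝒪) = J`… precisely `(J : ⊤) = J` for the colon by the unit ideal. [folklore] -/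
theorem colon_top_eq (J : Ideal R) : Submodule.colon J ((⊤ : Ideal R) : Set R) = J := by
  ext z
  rw [Submodule.mem_colon]
  constructor
  · intro h; simpa using h 1 Submodule.mem_top
  · intro hz q _; rw [smul_eq_mul]; exact Ideal.mul_mem_right _ _ hz

/-- In a Noetherian local ring which is not a field, `𝔪^m = 𝔪^n` forces `m = n`. [folklore] -/
theorem pow_maximalIdeal_injective [IsLocalRing R] [IsNoetherianRing R] [IsDomain R] (hR : ¬ IsField R) {m n : ℕ}
    (h : maximalIdeal R ^ m = maximalIdeal R ^ n) : m = n := by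
  by_contra hne
  rcases Nat.lt_or_gt_of_ne hne with hlt | hlt
  · apply maximalIdeal_pow_succ_ne hR m
    refine le_antisymm (Ideal.pow_le_pow_right (Nat.le_succ m)) ?_
    rw [h]; exact Ideal.pow_le_pow_right hlt
  · apply maximalIdeal_pow_succ_ne hR n
    refine le_antisymm (Ideal.pow_le_pow_right (Nat.le_succ n)) ?_
    rw [← h]; exact Ideal.pow_le_pow_right hlt

end Colon

variable {p : ℕ} [Fact p.Prime] {K : Type u} [Field K] [CharP K p]

/-- **The divisorial sum drops at the blow-up of a regular curve of the singular locus.** For the blow-up `π : Z′ → Z` of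
an ambient scheme along a centre `D` permissible for the standard `E = (J, b)` whose generic point `η` has codimension
one, with standard transform `E′`: `divisorialSum J′ + b ≤ divisorialSum J`, in particular `divisorialSum J′ < divisorialSum J`.
[cite: CossartPiltant2008, proof of Prop. 4.2] -/
theorem divisorialSum_transform_add_le_of_curveCentre (A A' : AmbientDatum p K) (E : IdealExponent A.Z) (hE : E.IsStandard)
    {D : Closeds A.Z} (hD : E.IsPermissibleCentre A.hom D) {η : A.Z} (hη : IsGenericPoint η (D : Set A.Z))
    (hcoh : Order.coheight η = 1) {π : A'.Z ⟶ A.Z} (hπ : IsBlowup π (vanishingIdeal D))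
    (hE' : (E.transform π D).IsStandard) :
    divisorialSum (E.transform π D).J + E.b ≤ divisorialSum E.J := by
  classical
  haveI := ambient_isIntegral A
  haveI := ambient_isIntegral A'
  haveI := A.smooth
  haveI := A.quasiCompact
  haveI := A'.smooth
  haveI := A'.quasiCompact
  haveI : IsLocallyNoetherian A.Z := ambient_isLocallyNoetherian A
  haveI : IsLocallyNoetherian A'.Z := ambient_isLocallyNoetherian A'
  haveI : CompactSpace A.Z := QuasiCompact.compactSpace_of_compactSpace A.hom
  haveI : CompactSpace A'.Z := QuasiCompact.compactSpace_of_compactSpace A'.hom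
  haveI : IsNoetherian A.Z := {}
  haveI : IsNoetherian A'.Z := {}
  haveI : IsIso π := isIso_of_curveCentre A A' hη hcoh hπ
  have hX : Scheme.IsRegular A.Z := ambient_isRegular A
  have hX' : Scheme.IsRegular A'.Z := ambient_isRegular A'
  set J := E.J with hJdef
  set J' := (E.transform π D).J with hJ'def
  have hJ : J ≠ ⊥ := hE.1
  have hJ' : J' ≠ ⊥ := hE'.1
  have hb : 0 < E.b := hE.2
  have hfin := finite_divisorialPoints (I := J) hJ
  have hfin' := finite_divisorialPoints (I := J') hJ'
  rw [divisorialSum_eq hfin, divisorialSum_eq hfin']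
  set S := hfin.toFinset with hS
  set T := hfin'.toFinset with hT
  have hmemS : ∀ ζ, ζ ∈ S ↔ ζ ∈ divisorialPoints J := fun ζ => Set.Finite.mem_toFinset hfin
  have hmemT : ∀ ζ, ζ ∈ T ↔ ζ ∈ divisorialPoints J' := fun ζ => Set.Finite.mem_toFinset hfin'
  -- the stalk identity along the isomorphism
  have hstalk : ∀ y' : A'.Z, ∃ e : A.Z.presheaf.stalk (π y') ≃+* A'.Z.presheaf.stalk y',
      stalkIdeal J' y' = (Submodule.colon (stalkIdeal J (π y'))
        (stalkIdeal (vanishingIdeal D) (π y') ^ E.b : Ideal (A.Z.presheaf.stalk (π y')))).map e := by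
    intro y'
    let e : A.Z.presheaf.stalk (π y') ≃+* A'.Z.presheaf.stalk y' := (asIso (π.stalkMap y')).commRingCatIsoToRingEquiv
    have he : e.toRingHom = (π.stalkMap y').hom := rfl
    refine ⟨e, ?_⟩
    show stalkIdeal (controlledTransform π (vanishingIdeal D) E.J E.b) y' = _
    rw [hπ.stalkIdeal_controlledTransform E.J E.b y', stalkIdeal_comap_eq_map_stalkMap,
      stalkIdeal_comap_eq_map_stalkMap, ← Ideal.map_pow, ← he]
    exact (map_colon_eq_of_ringEquiv e _ _).symm
  -- `η ∈ S` with `ord_η J ≥ b`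
  have hηsing : η ∈ E.sing := hD.subset_sing hη.mem
  have hηsupp : η ∈ J.support := by
    rw [mem_support_iff_stalkIdeal_le]
    exact ((mem_sing_iff_stalkIdeal_le_pow E η).mp hηsing).trans (Ideal.pow_le_self hb.ne')
  have hηS : η ∈ S := (hmemS η).mpr ⟨hηsupp, hcoh⟩
  obtain ⟨aη, haη, hJη⟩ := exists_stalkIdeal_eq_maximalIdeal_pow hX hcoh hJ
  have hbaη : E.b ≤ aη := by
    have h1 : ((E.b : ℕ) : ℕ∞) ≤ idealOrder J η :=
      (le_idealOrder_iff J η E.b).mpr ((mem_sing_iff_stalkIdeal_le_pow E η).mp hηsing)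
    rw [haη] at h1
    exact_mod_cast h1
  -- the comparison function on `S`
  let f : A.Z → ℕ := fun ζ => (idealOrder J ζ).toNat
  let f' : A'.Z → ℕ := fun ζ' => (idealOrder J' ζ').toNat
  let g : A.Z → ℕ := fun ζ => f ζ - (if ζ = η then E.b else 0)
  -- (1) `π` maps `T` injectively into `S`, with `f' ≤ g ∘ π`
  have hinj : Set.InjOn (fun ζ' : A'.Z => π ζ') T := fun a _ c _ h => π.isOpenEmbedding.injective h
  have hkey : ∀ ζ' ∈ T, π ζ' ∈ S ∧ f' ζ' ≤ g (π ζ') := by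
    intro ζ' hζ'
    obtain ⟨hsupp', hcoh'⟩ := (hmemT ζ').mp hζ'
    have hcohζ : Order.coheight (π ζ') = 1 := (coheight_eq_of_isOpenImmersion π).trans hcoh'
    obtain ⟨e, hst⟩ := hstalk ζ'
    haveI : IsRegularLocalRing (A.Z.presheaf.stalk (π ζ')) := hX (π ζ')
    haveI : IsRegularLocalRing (A'.Z.presheaf.stalk ζ') := hX' ζ'
    have hnf' : ¬ IsField (A'.Z.presheaf.stalk ζ') := not_isField_stalk_of_coheight_eq_one hcoh'
    -- `π ζ' ∈ V(J)`
    have hsuppζ : π ζ' ∈ J.support := by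
      rw [mem_support_iff_stalkIdeal_le]
      by_contra hnot
      have htop : stalkIdeal J (π ζ') = ⊤ := by
        by_contra hne
        exact hnot (IsLocalRing.le_maximalIdeal hne)
      have h := (mem_support_iff_stalkIdeal_le J' ζ').mp hsupp'
      rw [hst, htop, Submodule.top_colon, Ideal.map_top] at h
      exact (maximalIdeal.isMaximal _).ne_top (top_le_iff.mp h)
    obtain ⟨a, ha, hJζ⟩ := exists_stalkIdeal_eq_maximalIdeal_pow hX hcohζ hJ
    obtain ⟨a', ha', hJ'ζ⟩ := exists_stalkIdeal_eq_maximalIdeal_pow hX' hcoh' hJ'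
    refine ⟨(hmemS _).mpr ⟨hsuppζ, hcohζ⟩, ?_⟩
    -- compute the exponent `a'`
    have hmape : ∀ n : ℕ, (maximalIdeal (A.Z.presheaf.stalk (π ζ')) ^ n).map e = maximalIdeal (A'.Z.presheaf.stalk ζ') ^ n := by
      intro n; rw [Ideal.map_pow, IsLocalRing.map_ringEquiv_maximalIdeal]
    by_cases hζη : π ζ' = η
    · -- over `η`: the colon by `𝔪^b` of `𝔪^{aη}` is `𝔪^{aη - b}`
      have haa : a = aη := by
        have : (a : ℕ∞) = aη := by rw [← ha, ← haη, hζη]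
        exact_mod_cast this
      have hIη : stalkIdeal (vanishingIdeal D) (π ζ') = maximalIdeal _ := by
        rw [vanishingIdeal_eq_primeDivisorIdeal hη, hζη]; exact stalkIdeal_primeDivisorIdeal_self η
      have hd1 : ringKrullDim (A.Z.presheaf.stalk (π ζ')) = 1 := by
        rw [ringKrullDim_stalk_eq_coheight, hcohζ]; rfl
      haveI := Literature.RingTheory.RegularLocalRing.isDiscreteValuationRing_of_ringKrullDim_eq_one hd1
      obtain ⟨ϖ, hϖ⟩ := IsDiscreteValuationRing.exists_irreducible (A.Z.presheaf.stalk (π ζ'))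
      have hcol : Submodule.colon (stalkIdeal J (π ζ'))
          ((stalkIdeal (vanishingIdeal D) (π ζ') ^ E.b : Ideal (A.Z.presheaf.stalk (π ζ'))) : Set _) =
          maximalIdeal _ ^ (a - E.b) := by
        have h := colon_span_pow_eq hϖ (show E.b ≤ a by rw [haa]; exact hbaη)
        rw [hJζ, hIη]
        rw [hϖ.maximalIdeal_eq] at h ⊢
        simp only [Ideal.span_singleton_pow] at h ⊢
        exact h
      have ha'eq : a' = a - E.b := by
        apply pow_maximalIdeal_injective hnf'
        rw [← hJ'ζ, hst, hcol, hmape]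
      change (idealOrder J' ζ').toNat ≤ (idealOrder J (π ζ')).toNat - (if π ζ' = η then E.b else 0)
      rw [if_pos hζη, ha', ha, ENat.toNat_coe, ENat.toNat_coe, ha'eq]
    · -- off `η`: the centre's stalk ideal is the unit ideal, nothing changes
      have hnotD : π ζ' ∉ (D : Set A.Z) := by
        intro hmem
        have hsp : η ⤳ π ζ' := hη.specializes hmem
        exact hζη (eq_of_specializes_of_coheight_le hsp (by rw [hcohζ]; exact ENat.coe_ne_top 1)
          (by rw [hcoh, hcohζ])).symm
      have hIt : stalkIdeal (vanishingIdeal D) (π ζ') = ⊤ :=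
        stalkIdeal_eq_top_of_not_mem_support (by rw [← SetLike.mem_coe, coe_support_vanishingIdeal]; exact hnotD)
      have ha'eq : a' = a := by
        apply pow_maximalIdeal_injective hnf'
        rw [← hJ'ζ, hst, hIt, Ideal.top_pow, colon_top_eq, hJζ, hmape]
      change (idealOrder J' ζ').toNat ≤ (idealOrder J (π ζ')).toNat - (if π ζ' = η then E.b else 0)
      rw [if_neg hζη, ha', ha, ENat.toNat_coe, ENat.toNat_coe, ha'eq, Nat.sub_zero]
  -- (2) summation
  have hsub : T.image (fun ζ' => π ζ') ⊆ S := by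
    intro ζ hζ
    obtain ⟨ζ', hζ', rfl⟩ := Finset.mem_image.mp hζ
    exact (hkey ζ' hζ').1
  have h1 : ∑ ζ' ∈ T, f' ζ' ≤ ∑ ζ' ∈ T, g (π ζ') := Finset.sum_le_sum fun ζ' hζ' => (hkey ζ' hζ').2
  have h2 : ∑ ζ' ∈ T, g (π ζ') = ∑ ζ ∈ T.image (fun ζ' => π ζ'), g ζ := (Finset.sum_image hinj).symm
  have hgle : ∀ ζ, g ζ ≤ f ζ := fun ζ => Nat.sub_le _ _
  have h3 : ∑ ζ ∈ T.image (fun ζ' => π ζ'), g ζ + E.b ≤ ∑ ζ ∈ S, f ζ := by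
    by_cases hηT : η ∈ T.image (fun ζ' => π ζ')
    · -- the `η`-term is reduced by `b`
      have hfη : E.b ≤ f η := by change E.b ≤ (idealOrder J η).toNat; rw [haη, ENat.toNat_coe]; exact hbaη
      have hgη : g η + E.b = f η := by
        change f η - (if η = η then E.b else 0) + E.b = f η
        rw [if_pos rfl]
        omega
      calc ∑ ζ ∈ T.image (fun ζ' => π ζ'), g ζ + E.b
          = (g η + E.b) + ∑ ζ ∈ (T.image (fun ζ' => π ζ')).erase η, g ζ := by
            rw [← Finset.add_sum_erase _ _ hηT]; ring
        _ = f η + ∑ ζ ∈ (T.image (fun ζ' => π ζ')).erase η, g ζ := by rw [hgη]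
        _ ≤ f η + ∑ ζ ∈ S.erase η, f ζ :=
            Nat.add_le_add_left ((Finset.sum_le_sum fun ζ _ => hgle ζ).trans
              (Finset.sum_le_sum_of_subset_of_nonneg (Finset.erase_subset_erase η hsub)
                fun _ _ _ => Nat.zero_le _)) _
        _ = ∑ ζ ∈ S, f ζ := Finset.add_sum_erase _ _ hηS
    · -- `η` is not hit: add its term
      have hins : insert η (T.image (fun ζ' => π ζ')) ⊆ S := Finset.insert_subset hηS hsub
      have hfη : E.b ≤ f η := by change E.b ≤ (idealOrder J η).toNat; rw [haη, ENat.toNat_coe]; exact hbaη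
      calc ∑ ζ ∈ T.image (fun ζ' => π ζ'), g ζ + E.b
          ≤ ∑ ζ ∈ T.image (fun ζ' => π ζ'), f ζ + f η :=
            add_le_add (Finset.sum_le_sum fun ζ _ => hgle ζ) hfη
        _ = ∑ ζ ∈ insert η (T.image (fun ζ' => π ζ')), f ζ := by rw [Finset.sum_insert hηT, add_comm]
        _ ≤ ∑ ζ ∈ S, f ζ := Finset.sum_le_sum_of_subset_of_nonneg hins fun _ _ _ => Nat.zero_le _
  calc ∑ ζ' ∈ T, f' ζ' + E.b ≤ ∑ ζ' ∈ T, g (π ζ') + E.b := Nat.add_le_add_right h1 _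
    _ = ∑ ζ ∈ T.image (fun ζ' => π ζ'), g ζ + E.b := by rw [h2]
    _ ≤ ∑ ζ ∈ S, f ζ := h3

/-- **Strict decrease of the divisorial sum** along the blow-up of a regular curve of the singular locus.
[cite: CossartPiltant2008, proof of Prop. 4.2] -/
theorem divisorialSum_transform_lt_of_curveCentre (A A' : AmbientDatum p K) (E : IdealExponent A.Z) (hE : E.IsStandard)
    {D : Closeds A.Z} (hD : E.IsPermissibleCentre A.hom D) {η : A.Z} (hη : IsGenericPoint η (D : Set A.Z))
    (hcoh : Order.coheight η = 1) {π : A'.Z ⟶ A.Z} (hπ : IsBlowup π (vanishingIdeal D))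
    (hE' : (E.transform π D).IsStandard) :
    divisorialSum (E.transform π D).J < divisorialSum E.J := by
  have h := divisorialSum_transform_add_le_of_curveCentre A A' E hE hD hη hcoh hπ hE'
  have hb : 0 < E.b := hE.2
  omega

end CampaignW46

end Summit.ResolutionOfSingularities.ResolutionOfSingularities.Theorems

end
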